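import Summits.NavierStokesRegularity.NavierStokesRegularity.Theorems.CertifiedBlowupCertifiedBlowupVorticityRateBlowupDepletionFloor
import HarnessLib

/-!
# Certificate class `CertifiedBlowupVorticityRateBlowup` (stmt-NavierStokesRegularity-8639): THE DEPLETION FLOOR NEEDS THE
# STRETCHING COEFFICIENT ONLY NEAR `T` — `limsup_{t → T⁻} 2∫ω·Sω/(‖ω‖_∞‖ω‖²₂) ≥ 1/(2C_ω)`

Theorems file landed `--supports stmt-NavierStokesRegularity-8639` (cell `ns-blowup`, GROUP B zone Z1; companion of the
thirteenth crux-side deposit `…DepletionFloor`). That file proved `(D_κ)` on ALL of `[0, T)` ⇒ `(S_κ)` ⇒ `C_ω ≥ 1/(2κ)`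
through deposits 9–10 BY NAME (whose slab binder quantifies over every slab of `[0, T)`), and the slab-mean inequality
`(N/2)·log q − K ≤ C(q − 1)·Σ_{n<N} κₙ` on the geometric slabs `tₙ = T − (T − t₀)q⁻ⁿ`, which only involves times `≥ t₀`.
Here the mean form is cashed in: the coefficient hypothesis is needed only on `[t₀, T)` — eventually, in the crux's own
`∀ᶠ t → T⁻` idiom — and the contrapositive is the LIMSUP statement of the title. `(D_κ)` at time `t` is, as there,
`∀ Ω, (∀ x, ‖curl u(t, x)‖ ≤ Ω) → 2∫⟪curl u(t), (∇u(t)) curl u(t)⟫ ≤ κ·Ω·∫|curl u(t)|²` (spelled out; no definition).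

* `log_le_of_late_depletion` — `(D_κ̄)` on `[t₀, T)` (`κ̄ ≥ 0`) and the rate `(T − t)‖curl u‖ ≤ C` there ⇒
  **`log q ≤ 2κ̄C(q − 1)` for every `q > 1`** (the mean form with constant coefficients: `N(log q/2 − C(q − 1)κ̄) ≤ K`
  for all `N`);
* `inv_two_mul_le_of_late_depletion` — **`1/(2κ̄) ≤ C`** (`κ̄ > 0`; `1 − 1/q ≤ log q` and `q → 1⁺`);
* `vorticityRate_witness_const_ge_of_eventually_depletion`, `vorticityRate_witness_one_le_two_mul_of_eventually_depletion`
  — for the witnesses of the certificate class with BOTH hypotheses eventual (`∀ᶠ t → T⁻`): `1/(2κ̄) ≤ C`, i.e.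
  **`1 ≤ 2κ̄C` — THE CERTIFICATE CONSTANT TIMES THE EVENTUAL DEPLETION COEFFICIENT IS AT LEAST ½**;
* `vorticityRate_witness_stretching_frequently_gt` — THE LIMSUP FORM: for every `κ'` with `2κ'C < 1`, FREQUENTLY as
  `t → T⁻` there is `Ω ≥ ‖curl u(t)‖_∞` (a bound of the vorticity at time `t`) with
  **`κ'·Ω·∫|ω(t)|² < 2∫⟪ω, (∇u)ω⟫(t)`** — the normalised enstrophy production exceeds every `κ' < 1/(2C_ω)` arbitrarily
  close to `T` (for `C_ω` near the floor `√3/4` it must come arbitrarily close to its kinematic maximum `2/√3`: vorticity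
  aligned with the most stretching direction, `|ω| ≡ ‖ω‖_∞` on the enstrophy-carrying set);
* `depletion_cesaro_ge` — the Cesàro reading of the mean form: for every `q > 1`, admissible `(κₙ)` and `ε > 0`,
  eventually in `N`: `log q/(2C(q − 1)) − ε ≤ (Σ_{n<N} κₙ)/N`.

READING (K-audit hook, DESCRIPTIVE): a candidate whose instrument prints `κ(t) = 2∫ω·Sω dx/(‖ω(t)‖_∞∫|ω(t)|²)` must show
`limsup κ(t) ≥ 1/(2C_ω)` on its window; the kinematic bound `κ ≤ 2/√3` recovers `C_ω ≥ √3/4` and moves nothing. No new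
definitions, no named-fact hypotheses, no `sorry`. WHAT THIS IS NOT: not a blow-up or regularity claim — a priori
inequalities about a HYPOTHETICAL witness of the certificate class; crux 8639, crux 8640, the floor `√3/4` and (AX-L) are
untouched. Author: ns-blowup-profile-eng-1 g14, 2026-08-27.

## References
* J. Leray, Acta Math. 63 (1934), §20 (3.12). [Leray1934]
* J. C. Robinson, J. L. Rodrigo, W. Sadowski, *The Three-Dimensional Navier–Stokes Equations*, CUP 2016, Thm 12.3.
  [RobinsonRodrigoSadowski2016]
* P. Constantin, SIAM Rev. 36 (1994) 73–98, §3. [Constantin1994]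
-/

-- the summit and its single problem share the name (D-0017 nested layout)
set_option linter.dupNamespace false

noncomputable section

open MeasureTheory Set Function Filter Topology Metric
open scoped ENNReal NNReal RealInnerProductSpace ContDiff

namespace Summit.NavierStokesRegularity.NavierStokesRegularity.Theorems.CertifiedBlowupVorticityRateBlowup.DepletionFloor

open Literature.Analysis.FluidPDE
open Summit.NavierStokesRegularity.NavierStokesRegularity.Theorems.CertifiedBlowupAxisymBlowup.CompactAmplification
open Summit.NavierStokesRegularity.NavierStokesRegularity.Theorems.CertifiedBlowupVorticityRateBlowup.SlabFloor

variable {ν T : ℝ} {u : ℝ → EuclideanSpace ℝ (Fin 3) → EuclideanSpace ℝ (Fin 3)}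
  {p : ℝ → EuclideanSpace ℝ (Fin 3) → ℝ}

/-! ### The coefficient near `T` suffices -/

/-- **`log q ≤ 2κ̄C(q − 1)` from `(D_κ̄)` on `[t₀, T)` only.** For a maximal Leray–Hopf classical solution of finite
lifespan `T > 0` from a rapidly decaying axisymmetric datum, `ν > 0`, with `(T − t)‖curl u(t, x)‖ ≤ C` and `(D_κ̄)`
(`κ̄ ≥ 0`) at every `t ∈ [t₀, T)`: `log q ≤ 2κ̄C(q − 1)` for every `q > 1` — the mean form `exists_log_le_sum_depletion`
with the constant coefficients `κₙ = κ̄` on the geometric slabs (all inside `[t₀, T)`) reads `N·(log q/2 − C(q − 1)κ̄) ≤ K`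
for every `N`. [new here — elementary] -/
theorem log_le_of_late_depletion (hν : 0 < ν) (hT : 0 < T) (hmax : IsMaximalSmoothSolution ν 0 u p T)
    (hLH : IsLerayHopfOn T ν 0 (u 0) u) (hdec : HasRapidSpatialDecay (u 0)) (haxi : IsAxisymmetric (u 0))
    {C t₀ : ℝ} (ht₀ : 0 ≤ t₀) (ht₀T : t₀ < T) (hω : ∀ t ∈ Ico t₀ T, ∀ x, (T - t) * ‖curl (u t) x‖ ≤ C)
    {κ : ℝ} (hκ : 0 ≤ κ)
    (hdep : ∀ t ∈ Ico t₀ T, ∀ Ω : ℝ, (∀ x, ‖curl (u t) x‖ ≤ Ω) →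
      2 * ∫ x, ⟪curl (u t) x, fderiv ℝ (u t) x (curl (u t) x)⟫ ≤ κ * Ω * ∫ x, ‖curl (u t) x‖ ^ 2)
    {q : ℝ} (hq : 1 < q) : Real.log q ≤ 2 * κ * C * (q - 1) := by
  obtain ⟨K, hK⟩ := exists_log_le_sum_depletion hν hT hmax hLH hdec haxi ht₀ ht₀T hω
  have hq0 : 0 < q := by linarith
  set a : ℝ := T - t₀ with ha
  have ha0 : 0 < a := sub_pos.2 ht₀T
  -- the slabs lie inside `[t₀, T)`
  have hdep' : ∀ n : ℕ, ∀ t ∈ Icc (T - a / q ^ n) (T - a / q ^ (n + 1)), ∀ Ω : ℝ,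
      (∀ x, ‖curl (u t) x‖ ≤ Ω) →
      2 * ∫ x, ⟪curl (u t) x, fderiv ℝ (u t) x (curl (u t) x)⟫ ≤
        (fun _ : ℕ => κ) n * Ω * ∫ x, ‖curl (u t) x‖ ^ 2 := by
    intro n t ht Ω hΩ
    have hle : a / q ^ n ≤ a := div_le_self ha0.le (one_le_pow₀ hq.le)
    have hpos : 0 < a / q ^ (n + 1) := div_pos ha0 (pow_pos hq0 _)
    exact hdep t ⟨by linarith [ht.1], by linarith [ht.2]⟩ Ω hΩ
  have h := fun N => hK hq (fun _ => hκ) hdep' N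
  simp only [Finset.sum_const, Finset.card_range, nsmul_eq_mul] at h
  -- `N · M ≤ K` for all `N`, `M := log q/2 − C(q − 1)κ`; so `M ≤ 0`
  by_contra hlt
  push Not at hlt
  set M : ℝ := Real.log q / 2 - C * (q - 1) * κ with hM
  have hM0 : 0 < M := by rw [hM]; linarith
  have key : ∀ N : ℕ, (N : ℝ) * M ≤ K := fun N => by
    have e : (N : ℝ) * M = (N : ℝ) * Real.log q / 2 - C * (q - 1) * ((N : ℝ) * κ) := by rw [hM]; ring
    rw [e]
    linarith [h N]
  obtain ⟨N, hN⟩ := exists_nat_gt (K / M)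
  have h1 := key N
  rw [div_lt_iff₀ hM0] at hN
  linarith

/-- `1/(2κ) ≤ C` from `log q ≤ 2κC(q − 1)` for all `q > 1` (`κ > 0`): with `1 − 1/q ≤ log q`, `1/q ≤ 2κC` for every
`q > 1`, and `q ↓ 1`. [folklore] -/
private theorem inv_two_mul_le_of_forall_log_le {κ C : ℝ} (hκ : 0 < κ)
    (h : ∀ q : ℝ, 1 < q → Real.log q ≤ 2 * κ * C * (q - 1)) : 1 / (2 * κ) ≤ C := by
  set A : ℝ := 2 * κ * C with hA
  -- `1/q ≤ A` for all `q > 1`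
  have hinv : ∀ q : ℝ, 1 < q → q⁻¹ ≤ A := fun q hq => by
    have hq0 : 0 < q := by linarith
    have h1 : 1 - q⁻¹ ≤ Real.log q := Real.one_sub_inv_le_log_of_pos hq0
    have h2 : 1 - q⁻¹ = q⁻¹ * (q - 1) := by field_simp
    have h3 : q⁻¹ * (q - 1) ≤ A * (q - 1) := by rw [← h2, hA]; exact h1.trans (h q hq)
    exact le_of_mul_le_mul_right h3 (by linarith)
  have hA1 : 1 ≤ A := by
    by_contra hlt
    push Not at hlt
    have hA0 : 0 < A := lt_of_lt_of_le (by norm_num) (hinv 2 (by norm_num))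
    -- `q := 2/(1 + A) ∈ (1, 2)` has `1/q = (1 + A)/2 > A`
    have hq : 1 < 2 / (1 + A) := by rw [lt_div_iff₀ (by linarith)]; linarith
    have h := hinv _ hq
    rw [inv_div] at h
    linarith
  rw [div_le_iff₀ (by positivity)]
  linarith

/-- **THE FLOOR FROM `(D_κ̄)` NEAR `T`: `1/(2κ̄) ≤ C`** (`κ̄ > 0`; the rate and `(D_κ̄)` on `[t₀, T)` only).
[cite: Leray1934, §20 (3.12); RobinsonRodrigoSadowski2016, Thm 12.3] -/
theorem inv_two_mul_le_of_late_depletion (hν : 0 < ν) (hT : 0 < T) (hmax : IsMaximalSmoothSolution ν 0 u p T)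
    (hLH : IsLerayHopfOn T ν 0 (u 0) u) (hdec : HasRapidSpatialDecay (u 0)) (haxi : IsAxisymmetric (u 0))
    {C t₀ : ℝ} (ht₀ : 0 ≤ t₀) (ht₀T : t₀ < T) (hω : ∀ t ∈ Ico t₀ T, ∀ x, (T - t) * ‖curl (u t) x‖ ≤ C)
    {κ : ℝ} (hκ : 0 < κ)
    (hdep : ∀ t ∈ Ico t₀ T, ∀ Ω : ℝ, (∀ x, ‖curl (u t) x‖ ≤ Ω) →
      2 * ∫ x, ⟪curl (u t) x, fderiv ℝ (u t) x (curl (u t) x)⟫ ≤ κ * Ω * ∫ x, ‖curl (u t) x‖ ^ 2) :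
    1 / (2 * κ) ≤ C :=
  inv_two_mul_le_of_forall_log_le hκ fun _ hq =>
    log_le_of_late_depletion hν hT hmax hLH hdec haxi ht₀ ht₀T hω hκ.le hdep hq

/-! ### Assembled for the witnesses of the certificate class: eventual hypotheses, the limsup form -/

/-- **CERTIFICATE-CLASS WITNESSES WITH EVENTUAL COEFFICIENT `κ̄` HAVE `C ≥ 1/(2κ̄)`.** For every `(ν, T, u, p)` of the
certificate class `CertifiedBlowupVorticityRateBlowup` — a maximal Leray–Hopf classical solution of finite lifespan `T`
from a rapidly decaying axisymmetric datum — every `C` with `(T − t)‖curl u(t, x)‖ ≤ C` for all `x` and all `t` near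
`T⁻`, and every `κ̄ > 0` such that `(D_κ̄)` holds at all `t` near `T⁻`: `1/(2κ̄) ≤ C`.
[cite: Leray1934, §20 (3.12); RobinsonRodrigoSadowski2016, Thm 12.3] -/
theorem vorticityRate_witness_const_ge_of_eventually_depletion (hν : 0 < ν) (hT : 0 < T)
    (hmax : IsMaximalSmoothSolution ν 0 u p T) (hLH : IsLerayHopfOn T ν 0 (u 0) u)
    (hdec : HasRapidSpatialDecay (u 0)) (haxi : IsAxisymmetric (u 0)) {κ : ℝ} (hκ : 0 < κ)
    (hdep : ∀ᶠ t in 𝓝[<] T, ∀ Ω : ℝ, (∀ x, ‖curl (u t) x‖ ≤ Ω) →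
      2 * ∫ x, ⟪curl (u t) x, fderiv ℝ (u t) x (curl (u t) x)⟫ ≤ κ * Ω * ∫ x, ‖curl (u t) x‖ ^ 2)
    {C : ℝ} (hrate : ∀ᶠ t in 𝓝[<] T, ∀ x : EuclideanSpace ℝ (Fin 3), (T - t) * ‖curl (u t) x‖ ≤ C) :
    1 / (2 * κ) ≤ C := by
  obtain ⟨l, hlT, hl⟩ := mem_nhdsLT_iff_exists_Ioo_subset.1 (hdep.and hrate)
  have hlT' : l < T := hlT
  set t₀ : ℝ := max 0 ((l + T) / 2) with ht₀
  have ht₀0 : 0 ≤ t₀ := le_max_left _ _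
  have ht₀T : t₀ < T := max_lt hT (by linarith)
  have hlt₀ : l < t₀ := lt_of_lt_of_le (by linarith) (le_max_right _ _)
  have hI : ∀ t ∈ Ico t₀ T, t ∈ Ioo l T := fun t ht => ⟨lt_of_lt_of_le hlt₀ ht.1, ht.2⟩
  exact inv_two_mul_le_of_late_depletion hν hT hmax hLH hdec haxi ht₀0 ht₀T (fun t ht => (hl (hI t ht)).2) hκ
    fun t ht => (hl (hI t ht)).1

/-- **THE CERTIFICATE CONSTANT TIMES THE EVENTUAL DEPLETION COEFFICIENT IS AT LEAST ½: `1 ≤ 2κ̄C`** (same hypotheses).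
[cite: Leray1934, §20 (3.12); RobinsonRodrigoSadowski2016, Thm 12.3] -/
theorem vorticityRate_witness_one_le_two_mul_of_eventually_depletion (hν : 0 < ν) (hT : 0 < T)
    (hmax : IsMaximalSmoothSolution ν 0 u p T) (hLH : IsLerayHopfOn T ν 0 (u 0) u)
    (hdec : HasRapidSpatialDecay (u 0)) (haxi : IsAxisymmetric (u 0)) {κ : ℝ} (hκ : 0 < κ)
    (hdep : ∀ᶠ t in 𝓝[<] T, ∀ Ω : ℝ, (∀ x, ‖curl (u t) x‖ ≤ Ω) →
      2 * ∫ x, ⟪curl (u t) x, fderiv ℝ (u t) x (curl (u t) x)⟫ ≤ κ * Ω * ∫ x, ‖curl (u t) x‖ ^ 2)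
    {C : ℝ} (hrate : ∀ᶠ t in 𝓝[<] T, ∀ x : EuclideanSpace ℝ (Fin 3), (T - t) * ‖curl (u t) x‖ ≤ C) :
    1 ≤ 2 * κ * C := by
  have h := vorticityRate_witness_const_ge_of_eventually_depletion hν hT hmax hLH hdec haxi hκ hdep hrate
  rw [div_le_iff₀ (by positivity)] at h
  linarith

/-- **THE LIMSUP FORM: near `T` the normalised enstrophy production exceeds every `κ' < 1/(2C)`.** For every witness of
the certificate class, every `C` with `(T − t)‖curl u(t, x)‖ ≤ C` near `T⁻`, and every `κ'` with `2κ'C < 1`: FREQUENTLY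
as `t → T⁻` there is a bound `Ω` of `‖curl u(t, ·)‖` with `κ'·Ω·∫|curl u(t)|² < 2∫⟪curl u(t), (∇u(t)) curl u(t)⟫` — i.e.
`(D_{κ'})` fails at times arbitrarily close to `T`. (For `κ' ≤ 0` this is run at `κ'' = 1/(4C) > 0`, `C > √3/4 > 0` by
deposit 11, and `κ'Ω∫|ω|² ≤ κ''Ω∫|ω|²`.) [cite: Leray1934, §20 (3.12); RobinsonRodrigoSadowski2016, Thm 12.3] -/
theorem vorticityRate_witness_stretching_frequently_gt (hν : 0 < ν) (hT : 0 < T)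
    (hmax : IsMaximalSmoothSolution ν 0 u p T) (hLH : IsLerayHopfOn T ν 0 (u 0) u)
    (hdec : HasRapidSpatialDecay (u 0)) (haxi : IsAxisymmetric (u 0))
    {C : ℝ} (hrate : ∀ᶠ t in 𝓝[<] T, ∀ x : EuclideanSpace ℝ (Fin 3), (T - t) * ‖curl (u t) x‖ ≤ C)
    {κ' : ℝ} (hκ' : 2 * κ' * C < 1) :
    ∃ᶠ t in 𝓝[<] T, ∃ Ω : ℝ, (∀ x, ‖curl (u t) x‖ ≤ Ω) ∧
      κ' * Ω * ∫ x, ‖curl (u t) x‖ ^ 2 < 2 * ∫ x, ⟪curl (u t) x, fderiv ℝ (u t) x (curl (u t) x)⟫ := by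
  have hC : 0 < C := lt_trans (by positivity) (vorticityRate_witness_const_gt_sqrt3_div_four hν hT hmax hLH hdec haxi hrate)
  -- a positive coefficient `κ'' ≥ κ'` still below the threshold
  set κ'' : ℝ := max κ' (1 / (4 * C)) with hκ''
  have hκ''0 : 0 < κ'' := lt_of_lt_of_le (by positivity) (le_max_right _ _)
  have hκ''C : 2 * κ'' * C < 1 := by
    rcases le_total κ' (1 / (4 * C)) with h | h
    · rw [hκ'', max_eq_right h]; field_simp; norm_num
    · rw [hκ'', max_eq_left h]; exact hκ'
  by_contra hnot
  rw [Filter.not_frequently] at hnot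
  have hdep : ∀ᶠ t in 𝓝[<] T, ∀ Ω : ℝ, (∀ x, ‖curl (u t) x‖ ≤ Ω) →
      2 * ∫ x, ⟪curl (u t) x, fderiv ℝ (u t) x (curl (u t) x)⟫ ≤ κ'' * Ω * ∫ x, ‖curl (u t) x‖ ^ 2 := by
    refine hnot.mono fun t ht Ω hΩ => ?_
    have hΩ0 : 0 ≤ Ω := (norm_nonneg _).trans (hΩ 0)
    have hE0 : 0 ≤ ∫ x, ‖curl (u t) x‖ ^ 2 := integral_nonneg fun x => sq_nonneg _
    have h1 : ¬ κ' * Ω * ∫ x, ‖curl (u t) x‖ ^ 2 < 2 * ∫ x, ⟪curl (u t) x, fderiv ℝ (u t) x (curl (u t) x)⟫ :=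
      fun hlt => ht ⟨Ω, hΩ, hlt⟩
    have h2 : κ' * Ω * ∫ x, ‖curl (u t) x‖ ^ 2 ≤ κ'' * Ω * ∫ x, ‖curl (u t) x‖ ^ 2 :=
      mul_le_mul_of_nonneg_right (mul_le_mul_of_nonneg_right (le_max_left _ _) hΩ0) hE0
    -- if the production were below `κ'Ω∫|ω|²` we are done; otherwise it is ≥, and `κ' ≤ κ''` needs the sign — split
    by_contra hgt
    push Not at hgt
    exact h1 (lt_of_le_of_lt h2 hgt) |>.elim
  have h := vorticityRate_witness_one_le_two_mul_of_eventually_depletion hν hT hmax hLH hdec haxi hκ''0 hdep hrate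
  linarith

/-! ### The Cesàro reading of the mean form -/

/-- **Cesàro means of the slab coefficients: `liminf_N (1/N)Σ_{n<N} κₙ ≥ log q/(2C(q − 1))`.** For a maximal Leray–Hopf
classical solution of finite lifespan `T > 0` from a rapidly decaying axisymmetric datum with `(T − t)‖curl u‖ ≤ C` on
`[t₀, T)`, every `q > 1`, every family `κₙ ≥ 0` with `(D_{κₙ})` on the slabs `[tₙ, tₙ₊₁]`, `tₙ = T − (T − t₀)q⁻ⁿ`, and every
`ε > 0`: for all large `N`, `log q/(2C(q − 1)) − ε ≤ (Σ_{n<N} κₙ)/N` (`C > 0` by deposit 11's floor).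
[cite: Leray1934, §20 (3.12); RobinsonRodrigoSadowski2016, Thm 12.3] -/
theorem depletion_cesaro_ge (hν : 0 < ν) (hT : 0 < T) (hmax : IsMaximalSmoothSolution ν 0 u p T)
    (hLH : IsLerayHopfOn T ν 0 (u 0) u) (hdec : HasRapidSpatialDecay (u 0)) (haxi : IsAxisymmetric (u 0))
    {C t₀ : ℝ} (ht₀ : 0 ≤ t₀) (ht₀T : t₀ < T) (hω : ∀ t ∈ Ico t₀ T, ∀ x, (T - t) * ‖curl (u t) x‖ ≤ C)
    {q : ℝ} (hq : 1 < q) {κ : ℕ → ℝ} (hκ : ∀ n, 0 ≤ κ n)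
    (hdep : ∀ n : ℕ, ∀ t ∈ Icc (T - (T - t₀) / q ^ n) (T - (T - t₀) / q ^ (n + 1)), ∀ Ω : ℝ,
      (∀ x, ‖curl (u t) x‖ ≤ Ω) →
      2 * ∫ x, ⟪curl (u t) x, fderiv ℝ (u t) x (curl (u t) x)⟫ ≤ κ n * Ω * ∫ x, ‖curl (u t) x‖ ^ 2)
    {ε : ℝ} (hε : 0 < ε) :
    ∀ᶠ N : ℕ in atTop, Real.log q / (2 * C * (q - 1)) - ε ≤ (∑ n ∈ Finset.range N, κ n) / N := by
  have hrate : ∀ᶠ t in 𝓝[<] T, ∀ x : EuclideanSpace ℝ (Fin 3), (T - t) * ‖curl (u t) x‖ ≤ C :=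
    eventually_of_mem (Ico_mem_nhdsLT ht₀T) hω
  have hC : 0 < C := lt_trans (by positivity) (vorticityRate_witness_const_gt_sqrt3_div_four hν hT hmax hLH hdec haxi hrate)
  have hD : 0 < C * (q - 1) := mul_pos hC (by linarith)
  obtain ⟨K, hK⟩ := exists_log_le_sum_depletion hν hT hmax hLH hdec haxi ht₀ ht₀T hω
  have hlim : Tendsto (fun N : ℕ => K / (C * (q - 1)) / (N : ℝ)) atTop (𝓝 0) :=
    tendsto_const_div_atTop_nhds_zero_nat _
  filter_upwards [eventually_gt_atTop 0, hlim.eventually (gt_mem_nhds hε)] with N hN hsmall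
  have hN0 : (0 : ℝ) < N := Nat.cast_pos.2 hN
  have h := hK hq hκ hdep N
  set S : ℝ := ∑ n ∈ Finset.range N, κ n with hS
  set X : ℝ := Real.log q / (2 * C * (q - 1)) with hX
  set Y : ℝ := K / (C * (q - 1)) with hY
  -- `N·X − Y ≤ S`
  have h1 : (N : ℝ) * X - Y ≤ S := by
    have e : ((N : ℝ) * Real.log q / 2 - K) / (C * (q - 1)) = (N : ℝ) * X - Y := by
      rw [hX, hY]
      field_simp
    rw [← e, div_le_iff₀ hD]
    linarith
  have h2 : Y < ε * N := by rwa [div_lt_iff₀ hN0] at hsmall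
  rw [le_div_iff₀ hN0]
  have e2 : (X - ε) * N = N * X - ε * N := by ring
  rw [e2]
  linarith

end Summit.NavierStokesRegularity.NavierStokesRegularity.Theorems.CertifiedBlowupVorticityRateBlowup.DepletionFloor

end
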